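import Literature.NumberTheory.LFunctions.Zhang2022.DetectorEntangledMomentSOS
import Literature.NumberTheory.LFunctions.Zhang2022.DetectorEntangledMomentSOSConfluent
import Literature.NumberTheory.LFunctions.Zhang2022.DetectorEntangledUForm

/-!
# Zhang (2022), programme F-S3 (cell landau-siegel §E, E-102 head 1): the BOUNDARY form of the entangled cone is a
# SUM OF SQUARES — per block, at every node configuration, and summed over the palette

Y. Zhang, *Discrete mean estimates and the Landau–Siegel zero*, arXiv:2211.02515v1 [Zhang2022LandauSiegel] — an
unrefereed manuscript under adjudication. **WHAT THIS IS NOT: not a claim about Theorems 1–2 of arXiv:2211.02515, about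
Landau–Siegel zeros, or about Parity; nothing here asserts any analytic claim of the manuscript. «The programme SEARCHES
and TYPES; no claim about Landau–Siegel zeros, Theorems 1–2 of arXiv:2211.02515 or a repaired Margin232 until a kernel
theorem says so.»**

Cell desk note barrier/p2/R3a-ENTDBL-p2.md v2 (ls-barrier-p2 g4; theory referee PASS 2026-08-27T03:39:20Z; ball twins
num-2 j267202, Bdet-num-2 j267232/j267304). After the R3c block identity (`Det.formDetPolarDD_eq_bulkPolar_add_freeEndPolar`,
p492410) and the `u`-factorisation of the polar bulk form (`Det.bulkPolarOn_eq_uForm_of_oneSided`, `Det.uBoundaryJet`,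
p494055), the polar block of the entangled main term reads `(π/2)·P = Re m₀·uForm(ũ,ṽ) + [F(x_g,x_h) − Re m₀·β⁰(x_g,x_h)]`.
THIS FILE: the bracket — the whole BOUNDARY COUPLING of E-102 head 1 — is, in the jets `p = S(0)`, `ω = ũ(0)/(iπ)`
(`S′(0) = iπ(ω − x·p)`), the two-term Gram expression
`π²θcotθ·Re m₀·ω·conj ω′ + (π³/(4 sin θ))·L_x·conj L_y`, `L_x = σ̃(a,x)ω + 2i sinθ·κ(x)·p`, `θ = πa/2`,
stated in the `(E(a) − E(a)⁻¹)`-multiplied, `i`-free shape (`E(a) = e^{iπa/2}`, `2i sin θ = E − E⁻¹`, `2cos θ = E + E⁻¹`):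

* `boundary_sos_of` — the jet identity from the FOUR moment identities as hypotheses (abstract slots; pure algebra);
* `sosSigmaC` — the continuous jet coefficient `σ̃(a,c)` (= `Det.sosSigma a c` off `c = a`, the removable value
  `1 + iπa − E(a)²` at `c = a`); bridges `halfUnit ![…] m = halfExp …`;
* `freeEndPolarDD_sub_uBoundaryJet_eq_sos` — THE BLOCK BOUNDARY IDENTITY for EVERY real `a, x, y` (five node
  configurations: distinct p493460, diagonal / anchor-left / anchor-right / triple p494353);
* `entangledFreeEnd_sub_uBoundary_eq_sos` — summed over a palette: `2(E−E⁻¹)·[entangledFreeEnd − Σ_{jl} R_{jl}β⁰_{jl}]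
  = iπ³·[a(E+E⁻¹)·Σ_{jl} R_{jl} ω_j conj ω_l + (Σ_j L_j)·conj(Σ_j L_j)]`.

The positivity consequence (E-102 head 1: `ConePSD a b` for `a ∈ (0,1)`, every real palette) is assembled in the next
leaf from this file, the Picone form of `uForm` (p494471) and L-B′1 (`Det.re_ddM0_sum_nonneg_complex`, p488885).
Pure algebra; 0 facts, 0 sorry, standard axioms.
-/

noncomputable section

open Complex Real

namespace Literature.NumberTheory.LFunctions.Zhang2022

namespace Det

open scoped ComplexConjugate

/-! ### Part 1 — the jet identity from the four moment identities (abstract slots) -/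

section Generic

variable {a x y : ℝ}

/-- **The jet identity from the four moment identities.** Slots: `E` (for `E(a)`), `σx` (for `σ̃(a,x)`), `σy'` (for
`conj σ̃(a,y)`), `κx` (for `κ(x)`), `κy'` (for `conj κ(y)`); `m₀, m_s, m_n` the dd-moments of `![a,x,y]`. Given
(i) `ωω̄`, (ii) `ωγ̄`, (iii) `γω̄`, (iv) `γγ̄` in the shapes of `Det.momentSOS_*`, for all jets `p, ω, q, ω′`:
`2(E−E⁻¹)·[F_{(a,x,y)}(p, iπ(ω−xp); q, iπ(ω′−yq)) − Re m₀·β⁰(…)] = iπ³[a(E+E⁻¹)·Re m₀·ω conj ω′ + (σx·ω + (E−E⁻¹)κx·p)(σy'·conj ω′ − (E−E⁻¹)κy'·conj q)]`.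
Pure algebra (`linear_combination`). [cite: Zhang2022LandauSiegel, Prop 7.1 p.44 with (8.11)–(8.23)] -/
theorem boundary_sos_of {E σx σy' κx κy' : ℂ}
    (h1 : (E - E⁻¹) *
        (-((a + x + y : ℝ) : ℂ) * (ddM0 ![a, x, y] - conj (ddM0 ![a, x, y]))
          + 2 * (ddMs ![a, x, y] - conj (ddMs ![a, x, y]))
          - ((y - x : ℝ) : ℂ) * (ddM0 ![a, x, y] + conj (ddM0 ![a, x, y])))
      = 2 * σx * σy' + (a : ℂ) * (E + E⁻¹) * (ddM0 ![a, x, y] + conj (ddM0 ![a, x, y])))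
    (h2 : 2 * (y : ℂ) * (ddMs ![a, x, y] - conj (ddMs ![a, x, y]))
        - ((y * (a + x + y) : ℝ) : ℂ) * (ddM0 ![a, x, y] - conj (ddM0 ![a, x, y]))
        - 2 * ddMn ![a, x, y]
        + ((y * (a + x - y) : ℝ) : ℂ) * (ddM0 ![a, x, y] + conj (ddM0 ![a, x, y]))
      = 2 * σx * κy')
    (h3 : -(2 * (x : ℂ)) * (ddMs ![a, x, y] - conj (ddMs ![a, x, y]))
        + ((x * (a + x + y) : ℝ) : ℂ) * (ddM0 ![a, x, y] - conj (ddM0 ![a, x, y]))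
        - 2 * conj (ddMn ![a, x, y])
        + ((x * (a + y - x) : ℝ) : ℂ) * (ddM0 ![a, x, y] + conj (ddM0 ![a, x, y]))
      = 2 * σy' * κx)
    (h4 : ((x * y * (x + y) : ℝ) : ℂ) * (ddM0 ![a, x, y] - conj (ddM0 ![a, x, y]))
        - 2 * ((x * y : ℝ) : ℂ) * (ddMs ![a, x, y] - conj (ddMs ![a, x, y]))
        + ((x * y * (y - x) : ℝ) : ℂ) * (ddM0 ![a, x, y] + conj (ddM0 ![a, x, y]))
        + 2 * ((x : ℂ) * ddMn ![a, x, y] - (y : ℂ) * conj (ddMn ![a, x, y]))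
      = 2 * (E - E⁻¹) * κx * κy')
    (p ω q ω' : ℂ) :
    2 * (E - E⁻¹) *
        (freeEndPolarDD ![a, x, y] p (I * π * (ω - x * p)) q (I * π * (ω' - y * q))
          - (((ddM0 ![a, x, y]).re : ℝ) : ℂ) * uBoundaryJet a x y p (I * π * (ω - x * p)) q (I * π * (ω' - y * q)))
      = I * (π : ℂ) ^ 3 *
        ((a : ℂ) * (E + E⁻¹) * (((ddM0 ![a, x, y]).re : ℝ) : ℂ) * (ω * conj ω')
          + (σx * ω + (E - E⁻¹) * κx * p) * (σy' * conj ω' - (E - E⁻¹) * κy' * conj q)) := by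
  have hre : (((ddM0 ![a, x, y]).re : ℝ) : ℂ) = (ddM0 ![a, x, y] + conj (ddM0 ![a, x, y])) / 2 :=
    Complex.re_eq_add_conj _
  have him : ∀ z : ℂ, ((z.im : ℝ) : ℂ) = -I * (z - conj z) / 2 := fun z => by
    rw [Complex.im_eq_sub_conj]
    field_simp
    linear_combination (z - conj z) * Complex.I_sq
  unfold freeEndPolarDD uBoundaryJet symE1 symE3
  simp only [Matrix.cons_val_zero, Matrix.cons_val_one, Matrix.cons_val_two, Matrix.head_cons, Matrix.tail_cons]
  push_cast
  rw [hre, him, him]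
  simp only [map_mul, map_sub, Complex.conj_I, Complex.conj_ofReal]
  push_cast at h1 h2 h3 h4 ⊢
  linear_combination (I * π ^ 3 / 2) * (ω * conj ω') * h1
    - (I * π ^ 3 / 2) * (E - E⁻¹) * (ω * conj q) * h2
    + (I * π ^ 3 / 2) * (E - E⁻¹) * (p * conj ω') * h3
    - (I * π ^ 3 / 2) * (E - E⁻¹) * (p * conj q) * h4
    + (-(I * π ^ 3 / 2) * (E - E⁻¹) * ((ω - x * p) * (conj ω' - y * conj q))
        * (-((a : ℂ) + x + y) * (ddM0 ![a, x, y] - conj (ddM0 ![a, x, y]))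
            + 2 * (ddMs ![a, x, y] - conj (ddMs ![a, x, y]))
            - ((y : ℂ) - x) * (ddM0 ![a, x, y] + conj (ddM0 ![a, x, y])))) * Complex.I_sq

end Generic

/-! ### Part 2 — the canonical jet coefficient `σ̃`, the `halfUnit ↔ halfExp` bridges, and the block identity at
every node configuration -/

section Block

open scoped Classical in
/-- **The continuous jet coefficient `σ̃(a,c)`**: `Det.sosSigma a c` for `c ≠ a`, and the removable value
`1 + iπa − E(a)²` at `c = a` (num-2's confluent companion p494353). [cite: Zhang2022LandauSiegel, Prop 7.1 p.44 with (8.11)–(8.23)] -/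
def sosSigmaC (a c : ℝ) : ℂ := if c = a then 1 + I * π * (a : ℂ) - halfExp a * halfExp a else sosSigma a c

/-- Off the anchor `σ̃ = σ`. [cite: Zhang2022LandauSiegel, Prop 7.1 p.44 with (8.11)–(8.23)] -/
theorem sosSigmaC_of_ne {a c : ℝ} (h : c ≠ a) : sosSigmaC a c = sosSigma a c := by
  simp [sosSigmaC, h]

/-- At the anchor `σ̃(a,a) = 1 + iπa − E(a)²`. [cite: Zhang2022LandauSiegel, Prop 7.1 p.44 with (8.11)–(8.23)] -/
theorem sosSigmaC_self (a : ℝ) : sosSigmaC a a = 1 + I * π * (a : ℂ) - halfExp a * halfExp a := by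
  simp [sosSigmaC]

/-- `conj σ̃(a,a) = 1 − iπa − E(a)⁻²`. [cite: Zhang2022LandauSiegel, Prop 7.1 p.44 with (8.11)–(8.23)] -/
theorem conj_sosSigmaC_self (a : ℝ) :
    conj (sosSigmaC a a) = 1 - I * π * (a : ℂ) - (halfExp a)⁻¹ * (halfExp a)⁻¹ := by
  rw [sosSigmaC_self]
  simp only [map_sub, map_add, map_one, map_mul, Complex.conj_I, Complex.conj_ofReal, conj_halfExp]
  ring

/-- Bridge: `halfUnit b 0 = halfExp (b 0)` for `b = ![a,x,y]`. [cite: Zhang2022LandauSiegel, proof of Prop 7.1, (7.19)–(7.21)] -/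
theorem halfUnit_vec_zero (a x y : ℝ) : halfUnit ![a, x, y] 0 = halfExp a := by
  simp only [halfUnit, halfExp, Matrix.cons_val_zero]; congr 1; push_cast; ring

/-- Bridge: `halfUnit b 1 = halfExp (b 1)`. [cite: Zhang2022LandauSiegel, proof of Prop 7.1, (7.19)–(7.21)] -/
theorem halfUnit_vec_one (a x y : ℝ) : halfUnit ![a, x, y] 1 = halfExp x := by
  simp only [halfUnit, halfExp, Matrix.cons_val_one]; congr 1; push_cast; ring

/-- Bridge: `halfUnit b 2 = halfExp (b 2)`. [cite: Zhang2022LandauSiegel, proof of Prop 7.1, (7.19)–(7.21)] -/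
theorem halfUnit_vec_two (a x y : ℝ) : halfUnit ![a, x, y] 2 = halfExp y := by
  simp only [halfUnit, halfExp, Matrix.cons_val_two, Matrix.tail_cons, Matrix.head_cons]; congr 1; push_cast; ring

/-- **THE BLOCK BOUNDARY IDENTITY — every real anchored triple `(a; x, y)`** (repeats and anchor coincidences
included), in the jets `p = S_g(0)`, `ω = ũ_g(0)/(iπ)` (`S_g′(0) = iπ(ω − x·p)`), `q, ω′` likewise:
`2(E−E⁻¹)·[F_{(a,x,y)} − Re m₀·β⁰] = iπ³·[a(E+E⁻¹)·Re m₀·ω·conj ω′ + (σ̃(a,x)ω + (E−E⁻¹)κ(x)p)·(conj σ̃(a,y)·conj ω′ − (E−E⁻¹)·conj κ(y)·conj q)]`,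
`E = E(a) = e^{iπa/2}` — i.e. `F − Re m₀·β⁰ = π²θcotθ·Re m₀·ωω̄′ + (π³/(4 sin θ))·L_x·conj L_y`, `L_x = σ̃(a,x)ω + 2i sinθ·κ(x)p`
(cell note R3a-ENTDBL-p2 v2; five node configurations from p493460 / p494353).
[cite: Zhang2022LandauSiegel, Prop 7.1 p.44 with (8.11)–(8.23)] -/
theorem freeEndPolarDD_sub_uBoundaryJet_eq_sos (a x y : ℝ) (p ω q ω' : ℂ) :
    2 * (halfExp a - (halfExp a)⁻¹) *
        (freeEndPolarDD ![a, x, y] p (I * π * (ω - x * p)) q (I * π * (ω' - y * q))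
          - (((ddM0 ![a, x, y]).re : ℝ) : ℂ) * uBoundaryJet a x y p (I * π * (ω - x * p)) q (I * π * (ω' - y * q)))
      = I * (π : ℂ) ^ 3 *
        ((a : ℂ) * (halfExp a + (halfExp a)⁻¹) * (((ddM0 ![a, x, y]).re : ℝ) : ℂ) * (ω * conj ω')
          + (sosSigmaC a x * ω + (halfExp a - (halfExp a)⁻¹) * sosKappa x * p)
            * (conj (sosSigmaC a y) * conj ω' - (halfExp a - (halfExp a)⁻¹) * conj (sosKappa y) * conj q)) := by
  by_cases hxa : x = a
  · rw [hxa]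
    by_cases hya : y = a
    · -- triple coincidence x = y = a
      rw [hya]
      have key := boundary_sos_of (momentSOS_omega_omega_anchorAll a) (momentSOS_omega_gamma_anchorAll a)
        (momentSOS_gamma_omega_anchorAll a) (momentSOS_gamma_gamma_anchorAll a) p ω q ω'
      rw [halfUnit_vec_zero] at key
      rw [conj_sosSigmaC_self, sosSigmaC_self, conj_sosKappa, sosKappa_eq]
      linear_combination key
    · -- x = a ≠ y
      have key := boundary_sos_of (momentSOS_omega_omega_anchorLeft a y (Ne.symm hya))
        (momentSOS_omega_gamma_anchorLeft a y (Ne.symm hya)) (momentSOS_gamma_omega_anchorLeft a y (Ne.symm hya))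
        (momentSOS_gamma_gamma_anchorLeft a y (Ne.symm hya)) p ω q ω'
      rw [halfUnit_vec_zero, halfUnit_vec_two] at key
      rw [sosSigmaC_of_ne hya, conj_sosSigma, sosSigmaC_self, conj_sosKappa, sosKappa_eq]
      linear_combination key
  · by_cases hya : y = a
    · -- y = a ≠ x
      rw [hya]
      have key := boundary_sos_of (momentSOS_omega_omega_anchorRight a x (Ne.symm hxa))
        (momentSOS_omega_gamma_anchorRight a x (Ne.symm hxa)) (momentSOS_gamma_omega_anchorRight a x (Ne.symm hxa))
        (momentSOS_gamma_gamma_anchorRight a x (Ne.symm hxa)) p ω q ω'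
      rw [halfUnit_vec_zero, halfUnit_vec_one] at key
      rw [conj_sosSigmaC_self, sosSigmaC_of_ne hxa, sosSigma_eq, conj_sosKappa, sosKappa_eq]
      linear_combination key
    · by_cases hxy : x = y
      · -- diagonal x = y ≠ a
        rw [← hxy]
        have key := boundary_sos_of (momentSOS_omega_omega_diag a x (Ne.symm hxa))
          (momentSOS_omega_gamma_diag a x (Ne.symm hxa)) (momentSOS_gamma_omega_diag a x (Ne.symm hxa))
          (momentSOS_gamma_gamma_diag a x (Ne.symm hxa)) p ω q ω'
        rw [halfUnit_vec_zero, halfUnit_vec_one] at key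
        rw [sosSigmaC_of_ne hxa, conj_sosSigma, sosSigma_eq, conj_sosKappa, sosKappa_eq]
        linear_combination key
      · -- pairwise distinct
        have key := boundary_sos_of (momentSOS_omega_omega (Ne.symm hxa) (Ne.symm hya) hxy)
          (momentSOS_omega_gamma (Ne.symm hxa) (Ne.symm hya) hxy) (momentSOS_gamma_omega (Ne.symm hxa) (Ne.symm hya) hxy)
          (momentSOS_gamma_gamma (Ne.symm hxa) (Ne.symm hya) hxy) p ω q ω'
        rw [sosSigmaC_of_ne hxa, sosSigmaC_of_ne hya]
        exact key

end Block

/-! ### Part 3 — summed over a palette: the boundary coupling of the entangled cone is a cot-weighted `Re m₀`-Gram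
form plus ONE modulus square -/

section Palette

variable {K : ℕ}

/-- The boundary functional of channel `j`: `L_j = σ̃(a,b_j)·ω_j + (E(a)−E(a)⁻¹)·κ(b_j)·p_j`
(`= σ̃ω + 2i sinθ·κ·p`). [cite: Zhang2022LandauSiegel, Prop 7.1 p.44 with (8.11)–(8.23)] -/
def sosL (a : ℝ) (b : Fin K → ℝ) (p ω : Fin K → ℂ) (j : Fin K) : ℂ :=
  sosSigmaC a (b j) * ω j + (halfExp a - (halfExp a)⁻¹) * sosKappa (b j) * p j

/-- `conj (E − E⁻¹) = −(E − E⁻¹)` (`E − E⁻¹ = 2i sin θ` is purely imaginary). [cite: Zhang2022LandauSiegel, Prop 7.1 p.44 with (8.11)–(8.23)] -/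
theorem conj_halfExp_sub_inv (a : ℝ) : conj (halfExp a - (halfExp a)⁻¹) = -(halfExp a - (halfExp a)⁻¹) := by
  rw [map_sub, map_inv₀, conj_halfExp, inv_inv]; ring

/-- `conj L_j = conj σ̃·conj ω_j − (E−E⁻¹)·conj κ·conj p_j`. [cite: Zhang2022LandauSiegel, Prop 7.1 p.44 with (8.11)–(8.23)] -/
theorem conj_sosL (a : ℝ) (b : Fin K → ℝ) (p ω : Fin K → ℂ) (j : Fin K) :
    conj (sosL a b p ω j)
      = conj (sosSigmaC a (b j)) * conj (ω j) - (halfExp a - (halfExp a)⁻¹) * conj (sosKappa (b j)) * conj (p j) := by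
  rw [sosL, map_add, map_mul, map_mul, map_mul, conj_halfExp_sub_inv]; ring

/-- **THE BOUNDARY COUPLING OF THE ENTANGLED CONE IS A SUM OF SQUARES** (every real anchor `a`, every real palette
`b`, all jets; `E = E(a)`): `2(E−E⁻¹)·[entangledFreeEnd(a;b)(x⃗,x⃗) − Σ_{jl} Re m₀(a,b_j,b_l)·β⁰_{jl}(x⃗_j,x⃗_l)]
= iπ³·[a(E+E⁻¹)·Σ_{jl} Re m₀(a,b_j,b_l)·ω_j·conj ω_l + (Σ_j L_j)·conj(Σ_j L_j)]` with the jets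
`x⃗_j = (p_j, iπ(ω_j − b_j p_j))` (i.e. `p_j = S_j(0)`, `ω_j = ũ_j(0)/(iπ)`). With `E − E⁻¹ = 2i sin θ`, `E + E⁻¹ = 2cos θ`:
`[…] = π²θcotθ·Σ_{jl}R_{jl}ω_jω̄_l + (π³/(4 sinθ))·|Σ_j L_j|²` — both terms non-negative for `a ∈ (0,1)` by L-B′1
(`Det.re_ddM0_sum_nonneg_complex`). (Cell note R3a-ENTDBL-p2 v2 (I)/(III).)
[cite: Zhang2022LandauSiegel, Prop 7.1 p.44 with (8.11)–(8.23)] -/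
theorem entangledFreeEnd_sub_uBoundary_eq_sos (a : ℝ) (b : Fin K → ℝ) (p ω : Fin K → ℂ) :
    2 * (halfExp a - (halfExp a)⁻¹) *
        (entangledFreeEnd a b p (fun j => I * π * (ω j - b j * p j)) p (fun j => I * π * (ω j - b j * p j))
          - ∑ j, ∑ l, (((ddM0 ![a, b j, b l]).re : ℝ) : ℂ)
              * uBoundaryJet a (b j) (b l) (p j) (I * π * (ω j - b j * p j)) (p l) (I * π * (ω l - b l * p l)))
      = I * (π : ℂ) ^ 3 *
        ((a : ℂ) * (halfExp a + (halfExp a)⁻¹) * ∑ j, ∑ l, (((ddM0 ![a, b j, b l]).re : ℝ) : ℂ) * (ω j * conj (ω l))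
          + (∑ j, sosL a b p ω j) * conj (∑ j, sosL a b p ω j)) := by
  -- blockwise
  have hblock : ∀ j l,
      2 * (halfExp a - (halfExp a)⁻¹) *
          (freeEndPolarDD ![a, b j, b l] (p j) (I * π * (ω j - b j * p j)) (p l) (I * π * (ω l - b l * p l))
            - (((ddM0 ![a, b j, b l]).re : ℝ) : ℂ)
                * uBoundaryJet a (b j) (b l) (p j) (I * π * (ω j - b j * p j)) (p l) (I * π * (ω l - b l * p l)))
        = I * (π : ℂ) ^ 3 *
          ((a : ℂ) * (halfExp a + (halfExp a)⁻¹) * ((((ddM0 ![a, b j, b l]).re : ℝ) : ℂ) * (ω j * conj (ω l)))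
            + sosL a b p ω j * conj (sosL a b p ω l)) := by
    intro j l
    rw [freeEndPolarDD_sub_uBoundaryJet_eq_sos a (b j) (b l) (p j) (ω j) (p l) (ω l), conj_sosL, sosL]
    ring
  unfold entangledFreeEnd
  rw [← Finset.sum_sub_distrib]
  simp_rw [← Finset.sum_sub_distrib]
  rw [Finset.mul_sum]
  simp_rw [Finset.mul_sum, hblock]
  rw [map_sum, Finset.sum_mul_sum]
  conv_rhs => rw [mul_add, Finset.mul_sum, Finset.mul_sum, ← Finset.sum_add_distrib]
  refine Finset.sum_congr rfl fun j _ => ?_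
  conv_rhs => rw [Finset.mul_sum, Finset.mul_sum, ← Finset.sum_add_distrib]
  refine Finset.sum_congr rfl fun l _ => ?_
  ring

end Palette

end Det

end Literature.NumberTheory.LFunctions.Zhang2022
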